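import Literature.Analysis.FluidPDE.JiaSverak2014SlabPressureGauge
import Literature.Analysis.FluidPDE.DistributionalToWeakPressure
import Literature.Analysis.FluidPDE.NSSereginMildStabilityTools
import Literature.Analysis.FluidPDE.SuitableWeakRescaling
import Literature.Analysis.FluidPDE.LerayPressureDecayProofs
import Literature.Analysis.FluidPDE.CKNEpsilonRegularity
import HarnessLib

/-!
# Jia–Šverák 2014, proof of Thm. 3.2: the data of the localised Duhamel formula

Analysis/FluidPDE proofs file (theorems only, no new definitions, no new named facts), part of
the proof of the named fact `Literature.Analysis.FluidPDE.jia_sverak_2014_theorem_3_2`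
(`JiaSverak2014LocalRegularity.lean`; H. Jia, V. Šverák, Invent. Math. 196 (2014) =
arXiv:1204.0529, §3 Thm. 3.2). Inputs of the localised Duhamel representation
(`JiaSverak2014DuhamelWithDatum.lean`) and of the Hölder estimates of its terms
(`JiaSverak2014PotentialsHolder.lean`) for a local Leray solution:

* `IsLocalLeraySolutionOn.weakIdentity_datum_gauge` — the weak form **with initial datum** of a
  local Leray solution `(u, p)` on `(0,T') × ℝ³`, with the pressure replaced by a gauged
  pressure `p - c(t)`, `c ∈ L^{3/2}(0,T')` (the tree's cut-off argument
  `weakIdentity_datum_pressure_of_distributional`, Robinson–Rodrigo–Sadowski 2016 §3.1 (3.1),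
  fed with the slab class);
* `morreyOne_of_Lq_slices` — the `L¹`-Morrey constant of data in `L^∞_t L^q_x` supported in a
  slab `(0,T) × ℝ³` and in a ball (the class of the gauged pressure: print p. 9, "`p` is bounded
  in `B̄_{7/16} × [0,T]` modulo some function `p(t)`", here `L^q` instead of `L^∞`);
* `eLpNorm_localPressureNear_le_of_bound` — the near-field pressure of a bounded velocity is in
  `L^q` for every `1 < q < ∞` (Calderón–Zygmund, the tree's
  `stein1970_normalisedPressure_ae_Lp_bound_holds`);
* `exists_norm_localPressureFar_le_of_uloc` — the far-field pressure is bounded on the inner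
  ball by the uniformly local energy (the tree's `enorm_localPressureFar_le`,
  `exists_farField_tail_le`).

## References

* H. Jia, V. Šverák, Invent. Math. 196 (2014) = arXiv:1204.0529, §3, proof of Thm. 3.2 (p. 9),
  formula (3.3). Bib key `JiaSverak2014`.
* J. C. Robinson, J. L. Rodrigo, W. Sadowski, *The Three-Dimensional Navier–Stokes Equations*
  (2016), §3.1 (3.1). Bib key `RobinsonRodrigoSadowski2016`.
* K. Kang, H. Miura, T.-P. Tsai, IMRN 2021 = arXiv:1812.10509, Lemma 3.4. Bib key
  `KangMiuraTsai2020`.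
-/

noncomputable section

open MeasureTheory TopologicalSpace Set Function Filter Metric
open _root_.Topology
open scoped ENNReal NNReal RealInnerProductSpace Laplacian

namespace Literature.Analysis.FluidPDE

namespace JiaSverak2014

/-! ### The weak form with initial datum and a gauged pressure -/

set_option maxHeartbeats 800000 in
/-- **The weak form with initial datum of a local Leray solution with gauged pressure.** Let
`(u, p)` be a local Leray solution on `(0,T') × ℝ³` with measurable datum `u₀`, `0 < T ≤ T'`, and
`c ∈ L^{3/2}(0,T')` a time gauge. Then for every test field `ψ` on `(-∞, T) × ℝ³`,
`∫₀ᵀ∫ (⟪u, ∂ₜψ⟫ + ⟪u, (u·∇)ψ⟫ + ⟪u, Δψ⟫ + (p - c) div ψ) + ∫ ⟪u₀, ψ(0)⟫ = 0`.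
[cite: RobinsonRodrigoSadowski2016, §3.1 p. 58 (3.1)] [cite: KangMiuraTsai2020, Def. 3.1–3.2] -/
theorem _root_.Literature.Analysis.FluidPDE.IsLocalLeraySolutionOn.weakIdentity_datum_gauge
    {T' T : ℝ} {u₀ : (EuclideanSpace ℝ (Fin 3)) → (EuclideanSpace ℝ (Fin 3))}
    {u : ℝ → (EuclideanSpace ℝ (Fin 3)) → (EuclideanSpace ℝ (Fin 3))} {p : ℝ → (EuclideanSpace ℝ (Fin 3)) → ℝ}
    (hu : IsLocalLeraySolutionOn T' 1 u₀ u p) (hm₀ : AEStronglyMeasurable u₀ volume)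
    (hT : 0 < T) (hTT' : T ≤ T') {c : ℝ → ℝ} (hc : MemLp c (3 / 2 : ℝ≥0∞) (volume.restrict (Ioo 0 T')))
    {ψ : ℝ → (EuclideanSpace ℝ (Fin 3)) → (EuclideanSpace ℝ (Fin 3))}
    (hψ : IsSpaceTimeTestOn (slab (EuclideanSpace ℝ (Fin 3)) (Iio T) isOpen_Iio) ψ) :
    (∫ t in Ioo 0 T, ∫ x, (⟪u t x, timeDeriv ψ t x⟫ + ⟪u t x, convect (u t) (ψ t) x⟫ +
        1 * ⟪u t x, Δ (ψ t) x⟫ + (p t x - c t) * VectorCalculus.divergence (ψ t) x)) +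
      ∫ x, ⟪u₀ x, ψ 0 x⟫ = 0 := by
  have hu' : IsLocalLeraySolutionOn T 1 u₀ u p := hu.mono hTT'
  -- measurability and square integrability up to `t = 0`
  have hmeas : AEStronglyMeasurable (uncurry u)
      ((volume : Measure (ℝ × (EuclideanSpace ℝ (Fin 3)))).restrict (Ioo 0 T ×ˢ univ)) := hu'.aestronglyMeasurable
  have hsq : ∀ K : Set (EuclideanSpace ℝ (Fin 3)), IsCompact K → ∫⁻ z in Ioo 0 T ×ˢ K, ‖uncurry u z‖ₑ ^ 2 < ∞ :=
    fun K hK => hu'.sqIntegrable K hK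
  have hUK : ∀ K : Set (EuclideanSpace ℝ (Fin 3)), IsCompact K → IntegrableOn (uncurry u) (Ioo 0 T ×ˢ K) volume ∧
      IntegrableOn (fun z => ‖uncurry u z‖ ^ 2) (Ioo 0 T ×ˢ K) volume := fun K hK =>
    integrableOn_cylinder_of_lintegral_sq_slab hmeas hsq hK
  -- the gauged pressure
  have hcT : MemLp c (3 / 2 : ℝ≥0∞) (volume.restrict (Ioo 0 T)) :=
    hc.mono_measure (Measure.restrict_mono (Ioo_subset_Ioo_right hTT') le_rfl)
  have hslab : IsSuitableWeakSolutionOn (slab (EuclideanSpace ℝ (Fin 3)) (Ioo 0 T) isOpen_Ioo)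
      1 0 u (fun s x => p s x - c s) := hu'.suitable.sub_timeGauge_slab hcT
  have hdist := hslab.distributional
  have hmom : ∀ ψ' : ℝ → (EuclideanSpace ℝ (Fin 3)) → (EuclideanSpace ℝ (Fin 3)),
      IsSpaceTimeTestOn (slab (EuclideanSpace ℝ (Fin 3)) (Ioo 0 T) isOpen_Ioo) ψ' →
      ∫ z in Ioo 0 T ×ˢ (univ : Set (EuclideanSpace ℝ (Fin 3))), (⟪u z.1 z.2, timeDeriv ψ' z.1 z.2⟫ +
        ⟪u z.1 z.2, convect (u z.1) (ψ' z.1) z.2⟫ + 1 * ⟪u z.1 z.2, Δ (ψ' z.1) z.2⟫ +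
        (fun s x => p s x - c s) z.1 z.2 * VectorCalculus.divergence (ψ' z.1) z.2 +
        ⟪(0 : ℝ → (EuclideanSpace ℝ (Fin 3)) → (EuclideanSpace ℝ (Fin 3))) z.1 z.2, ψ' z.1 z.2⟫) = 0 :=
    fun ψ' hψ' => hdist.2.2.2.2 ψ' hψ'
  have hf : ∀ K : Set (EuclideanSpace ℝ (Fin 3)), IsCompact K →
      IntegrableOn (uncurry (0 : ℝ → (EuclideanSpace ℝ (Fin 3)) → (EuclideanSpace ℝ (Fin 3)))) (Ioo 0 T ×ˢ K) volume :=
    fun K hK => integrableOn_zero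
  -- integrability of the gauged pressure on the finite cylinders
  have hpK : ∀ K : Set (EuclideanSpace ℝ (Fin 3)), IsCompact K →
      IntegrableOn (uncurry fun s x => p s x - c s) (Ioo 0 T ×ˢ K) volume := by
    intro K hK
    haveI : IsFiniteMeasure ((volume : Measure (ℝ × (EuclideanSpace ℝ (Fin 3)))).restrict (Ioo 0 T ×ˢ K)) :=
      ⟨by rw [Measure.restrict_apply_univ]; exact volume_Ioo_prod_lt_top hK⟩
    have hsub : Ioo 0 T ×ˢ K ⊆ ((slab (EuclideanSpace ℝ (Fin 3)) (Ioo 0 T) isOpen_Ioo :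
        Opens (ℝ × (EuclideanSpace ℝ (Fin 3)))) : Set (ℝ × (EuclideanSpace ℝ (Fin 3)))) :=
      fun z hz => mem_slab.2 hz.1
    -- `p ∈ L^{3/2}((0,T) × K) ⊂ L¹`
    have hp1 : IntegrableOn (uncurry p) (Ioo 0 T ×ˢ K) volume := by
      have hm : AEStronglyMeasurable (uncurry p) ((volume : Measure (ℝ × (EuclideanSpace ℝ (Fin 3)))).restrict (Ioo 0 T ×ˢ K)) :=
        (hu'.suitable.distributional.2.2.1.mono_set hsub).aestronglyMeasurable
      exact BradshawTsai2019.integrable_of_lintegral_rpow_enorm_lt_top hm (by norm_num : (1 : ℝ) ≤ 3 / 2) (hu'.pressure K hK)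
    -- `c ∈ L^{3/2}(0,T) ⊂ L¹(0,T)`, constant in `x` on `K`
    have hc1 : IntegrableOn (fun z : ℝ × (EuclideanSpace ℝ (Fin 3)) => c z.1) (Ioo 0 T ×ˢ K) volume := by
      haveI : IsFiniteMeasure ((volume : Measure ℝ).restrict (Ioo 0 T)) := ⟨by
        rw [Measure.restrict_apply_univ]; exact measure_Ioo_lt_top⟩
      have h32 : (1 : ℝ≥0∞) ≤ 3 / 2 :=
        ((ENNReal.lt_div_iff_mul_lt (Or.inl two_ne_zero) (Or.inl ENNReal.ofNat_ne_top)).2 (by norm_num)).le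
      have hci : Integrable c ((volume : Measure ℝ).restrict (Ioo 0 T)) := hcT.integrable h32
      haveI : IsFiniteMeasure ((volume : Measure (EuclideanSpace ℝ (Fin 3))).restrict K) :=
        ⟨by rw [Measure.restrict_apply_univ]; exact hK.measure_lt_top⟩
      have h1 : Integrable (fun _ : EuclideanSpace ℝ (Fin 3) => (1 : ℝ)) ((volume : Measure (EuclideanSpace ℝ (Fin 3))).restrict K) :=
        integrable_const _
      have h := hci.mul_prod h1
      rw [IntegrableOn, Measure.volume_eq_prod, ← Measure.prod_restrict]
      simpa using h
    exact hp1.sub hc1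
  have hgood := ae_slice_aestronglyMeasurable_and_lintegral_ball_lt_top hmeas hsq
  have key := weakIdentity_datum_pressure_of_distributional hT hUK hmom hf hpK hgood hm₀
    (fun K hK => hu'.initial K hK) hψ
  simpa only [Pi.zero_apply, inner_zero_left, add_zero] using key

/-! ### `L¹`-Morrey constants of `L^∞_t L^q_x` data -/

/-- Hölder on a set: `∫_s |f| ≤ ‖f‖_{L^q} μ(s)^{1 - 1/q}` (`1 ≤ q`). [folklore] -/
theorem setLIntegral_enorm_le_eLpNorm_mul_measure_rpow {α : Type*} [MeasurableSpace α] {μ : Measure α}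
    {f : α → ℝ} (hf : AEStronglyMeasurable f μ) {q : ℝ≥0∞} (hq : 1 ≤ q) (s : Set α) :
    ∫⁻ x in s, ‖f x‖ₑ ∂μ ≤ eLpNorm f q μ * μ s ^ (1 - 1 / q.toReal) := by
  have h1 : ∫⁻ x in s, ‖f x‖ₑ ∂μ = eLpNorm f 1 (μ.restrict s) := by
    rw [eLpNorm_one_eq_lintegral_enorm]
  rw [h1]
  have h2 := eLpNorm_le_eLpNorm_mul_rpow_measure_univ hq (hf.restrict (s := s))
  rw [Measure.restrict_apply_univ] at h2
  refine h2.trans (mul_le_mul' (eLpNorm_mono_measure f Measure.restrict_le_self) (le_of_eq ?_))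
  congr 1
  simp [ENNReal.toReal_one]

set_option maxHeartbeats 1600000 in
/-- **`L¹`-Morrey constant of `L^∞_t L^q_x` data.** Let `f : ℝ × ℝ³ → ℝ` vanish off the slab
`(0,T) × ℝ³` (`0 < T`) and off `ℝ × B(x₀, ρ)`, with measurable slices whose `L^q` norms
(`1 ≤ q < ∞`) are `≤ P` for a.e. `t ∈ (0,T)`. Then for every exponent `0 < d ≤ 5 - 3/q` and
every cylinder, `∫_{Q*_r(c)} |f| ≤ (2 P |B₁|^{1-1/q} + T P |B_ρ|^{1-1/q}) r^d`
(`r ≤ 1`: `|I| ≤ 2r²` and Hölder on `B(c, r)`; `r ≥ 1`: `|I ∩ (0,T)| ≤ T` and Hölder on `B(x₀, ρ)`).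
[folklore] -/
theorem morreyOne_of_Lq_slices {f : ℝ × (EuclideanSpace ℝ (Fin 3)) → ℝ} {T ρ : ℝ} (hT : 0 < T)
    {x₀ : EuclideanSpace ℝ (Fin 3)}
    (hfS : ∀ z : ℝ × EuclideanSpace ℝ (Fin 3), z.1 ∉ Ioo 0 T → f z = 0)
    (hfρ : ∀ z : ℝ × EuclideanSpace ℝ (Fin 3), z.2 ∉ ball x₀ ρ → f z = 0)
    (hfm : ∀ t, AEStronglyMeasurable (fun x => f (t, x)) volume)
    {q : ℝ≥0∞} (hq : 1 ≤ q) (hqt : q ≠ ⊤) {P : ℝ≥0∞} (hPt : P ≠ ⊤)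
    (hslice : ∀ᵐ t ∂(volume.restrict (Ioo 0 T)), eLpNorm (fun x => f (t, x)) q volume ≤ P)
    {d : ℝ} (hd0 : 0 < d) (hd : d ≤ 5 - 3 / q.toReal)
    (c : ℝ × EuclideanSpace ℝ (Fin 3)) {r : ℝ} (hr : 0 < r) :
    ∫⁻ w in FluidPDE.parabolicCylinderCentered r c, ‖f w‖ₑ ≤
      ENNReal.ofReal ((2 * P.toReal * ((volume (ball (0 : EuclideanSpace ℝ (Fin 3)) 1)).toReal) ^ (1 - 1 / q.toReal) +
        T * P.toReal * ((volume (ball x₀ ρ)).toReal) ^ (1 - 1 / q.toReal)) * r ^ d) := by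
  set e : ℝ := 1 - 1 / q.toReal with he
  have hq1 : 1 ≤ q.toReal := by
    have := ENNReal.toReal_mono hqt hq
    simpa using this
  have hqpos : 0 < q.toReal := by linarith
  have he0 : 0 ≤ e := by
    rw [he, sub_nonneg, div_le_one hqpos]; exact hq1
  have he1 : e ≤ 1 := by
    have : 0 ≤ 1 / q.toReal := by positivity
    rw [he]; linarith
  set I : Set ℝ := Ioo (c.1 - r ^ 2) (c.1 + r ^ 2) with hI
  set B : Set (EuclideanSpace ℝ (Fin 3)) := ball c.2 r with hB
  have hQ : FluidPDE.parabolicCylinderCentered r c = I ×ˢ B := rfl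
  set V₁ : ℝ≥0∞ := volume (ball (0 : EuclideanSpace ℝ (Fin 3)) 1) with hV₁
  have hV₁t : V₁ ≠ ⊤ := measure_ball_lt_top.ne
  have hVρt : volume (ball x₀ ρ) ≠ ⊤ := measure_ball_lt_top.ne
  -- ### the slice bound: `∫_B |f(t)| ≤ P · min(|B|, |B_ρ|)^e` for a.e. `t ∈ (0,T)`, and `0` off `(0,T)`
  have hsliceB : ∀ t, eLpNorm (fun x => f (t, x)) q volume ≤ P →
      ∫⁻ x in B, ‖f (t, x)‖ₑ ≤ P * (min (volume B) (volume (ball x₀ ρ))) ^ e := by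
    intro t ht
    -- integrate over `B ∩ B(x₀, ρ)` only
    have hvan : ∫⁻ x in B, ‖f (t, x)‖ₑ = ∫⁻ x in B ∩ ball x₀ ρ, ‖f (t, x)‖ₑ := by
      rw [← lintegral_indicator (measurableSet_ball.inter measurableSet_ball),
        ← lintegral_indicator measurableSet_ball]
      refine lintegral_congr fun x => ?_
      by_cases hx : x ∈ B
      · by_cases hx' : x ∈ ball x₀ ρ
        · rw [indicator_of_mem hx, indicator_of_mem (show x ∈ B ∩ ball x₀ ρ from ⟨hx, hx'⟩)]
        · rw [indicator_of_mem hx, indicator_of_notMem (fun h => hx' h.2), hfρ (t, x) hx', enorm_zero]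
      · rw [indicator_of_notMem hx, indicator_of_notMem (fun h => hx h.1)]
    rw [hvan]
    have h := setLIntegral_enorm_le_eLpNorm_mul_measure_rpow (hfm t) hq (B ∩ ball x₀ ρ)
    refine h.trans (mul_le_mul' ht (ENNReal.rpow_le_rpow ?_ he0))
    exact le_min (measure_mono inter_subset_left) (measure_mono inter_subset_right)
  -- ### Tonelli (inequality) and the time integral
  have hprod : (volume.restrict (I ×ˢ B) : Measure (ℝ × EuclideanSpace ℝ (Fin 3))) =
      (volume.restrict I).prod (volume.restrict B) := by
    rw [Measure.volume_eq_prod, Measure.prod_restrict]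
  have hstep1 : ∫⁻ w in I ×ˢ B, ‖f w‖ₑ ≤ ∫⁻ t in I, ∫⁻ x in B, ‖f (t, x)‖ₑ := by
    rw [show (∫⁻ w in I ×ˢ B, ‖f w‖ₑ) = ∫⁻ w, ‖f w‖ₑ ∂((volume.restrict I).prod (volume.restrict B)) by rw [hprod]]
    exact lintegral_prod_le _
  -- the inner integral is a.e. bounded by the constant `Φ := P min(|B|,|B_ρ|)^e` on `(0,T)` and vanishes off it
  set Φ : ℝ≥0∞ := P * (min (volume B) (volume (ball x₀ ρ))) ^ e with hΦ
  have hinner : ∀ᵐ t ∂(volume.restrict I), ∫⁻ x in B, ‖f (t, x)‖ₑ ≤ (Ioo 0 T).indicator (fun _ => Φ) t := by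
    -- a.e. on `I`: split according to `t ∈ (0,T)`
    have hall : ∀ᵐ t ∂(volume : Measure ℝ), t ∈ Ioo 0 T → eLpNorm (fun x => f (t, x)) q volume ≤ P :=
      (ae_restrict_iff' measurableSet_Ioo).1 hslice
    filter_upwards [ae_restrict_of_ae hall] with t ht
    by_cases htI : t ∈ Ioo 0 T
    · rw [indicator_of_mem htI]; exact hsliceB t (ht htI)
    · rw [indicator_of_notMem htI]
      have : ∫⁻ x in B, ‖f (t, x)‖ₑ = 0 := by
        refine (lintegral_congr fun x => ?_).trans lintegral_zero
        rw [hfS (t, x) htI, enorm_zero]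
      rw [this]
  have hstep2 : ∫⁻ t in I, ∫⁻ x in B, ‖f (t, x)‖ₑ ≤ Φ * volume (I ∩ Ioo 0 T) := by
    calc ∫⁻ t in I, ∫⁻ x in B, ‖f (t, x)‖ₑ ≤ ∫⁻ t in I, (Ioo 0 T).indicator (fun _ => Φ) t := lintegral_mono_ae hinner
      _ = Φ * volume (I ∩ Ioo 0 T) := by
          rw [lintegral_indicator measurableSet_Ioo, setLIntegral_const, Measure.restrict_apply measurableSet_Ioo,
            inter_comm]
  rw [hQ]
  refine (hstep1.trans hstep2).trans ?_
  -- ### the two regimes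
  have hP0 : 0 ≤ P.toReal := ENNReal.toReal_nonneg
  have hV₁0 : 0 ≤ V₁.toReal := ENNReal.toReal_nonneg
  have hVρ0 : 0 ≤ (volume (ball x₀ ρ)).toReal := ENNReal.toReal_nonneg
  set A₁ : ℝ := 2 * P.toReal * V₁.toReal ^ e with hA₁
  set A₂ : ℝ := T * P.toReal * (volume (ball x₀ ρ)).toReal ^ e with hA₂
  have hA₁0 : 0 ≤ A₁ := by positivity
  have hA₂0 : 0 ≤ A₂ := by positivity
  by_cases hr1 : r ≤ 1
  · -- small cylinders: `|I| = 2r²`, `|B| = |B₁| r³`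
    have hvolI : volume (I ∩ Ioo 0 T) ≤ ENNReal.ofReal (2 * r ^ 2) := by
      calc volume (I ∩ Ioo 0 T) ≤ volume I := measure_mono inter_subset_left
        _ = ENNReal.ofReal (2 * r ^ 2) := by rw [hI, Real.volume_Ioo]; congr 1; ring
    have hvolB : volume B = ENNReal.ofReal (r ^ 3) * V₁ := by
      rw [hB, Measure.addHaar_ball volume c.2 hr.le, finrank_euclideanSpace_fin, hV₁]
    have hmin : (min (volume B) (volume (ball x₀ ρ))) ^ e ≤ (ENNReal.ofReal (r ^ 3) * V₁) ^ e :=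
      ENNReal.rpow_le_rpow ((min_le_left _ _).trans (le_of_eq hvolB)) he0
    calc Φ * volume (I ∩ Ioo 0 T) ≤ (P * (ENNReal.ofReal (r ^ 3) * V₁) ^ e) * ENNReal.ofReal (2 * r ^ 2) :=
          mul_le_mul' (mul_le_mul' le_rfl hmin) hvolI
      _ = ENNReal.ofReal (A₁ * r ^ (3 * e + 2)) := by
          rw [ENNReal.mul_rpow_of_nonneg _ _ he0, ENNReal.ofReal_rpow_of_nonneg (by positivity) he0,
            ← ENNReal.ofReal_toReal hPt, ← ENNReal.ofReal_toReal hV₁t,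
            ENNReal.ofReal_rpow_of_nonneg ENNReal.toReal_nonneg he0,
            ← ENNReal.ofReal_mul (by positivity), ← ENNReal.ofReal_mul hP0, ← ENNReal.ofReal_mul (by positivity)]
          congr 1
          have e3 : (r ^ 3) ^ e = r ^ (3 * e) := by
            rw [← Real.rpow_natCast r 3, ← Real.rpow_mul hr.le]; norm_num
          have e32 : r ^ (3 * e + 2) = r ^ (3 * e) * r ^ 2 := by
            rw [Real.rpow_add hr, Real.rpow_two]
          rw [e3, e32, hA₁]; ring
      _ ≤ ENNReal.ofReal ((A₁ + A₂) * r ^ d) := by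
          refine ENNReal.ofReal_le_ofReal ?_
          have hexp : d ≤ 3 * e + 2 := by
            have : (3 : ℝ) / q.toReal = 3 * (1 / q.toReal) := by ring
            rw [he]; linarith
          have hpow : r ^ (3 * e + 2) ≤ r ^ d := Real.rpow_le_rpow_of_exponent_ge hr hr1 hexp
          calc A₁ * r ^ (3 * e + 2) ≤ A₁ * r ^ d := mul_le_mul_of_nonneg_left hpow hA₁0
            _ ≤ (A₁ + A₂) * r ^ d := by gcongr; linarith
  · -- large cylinders: `|I ∩ (0,T)| ≤ T`, `|B ∩ B_ρ| ≤ |B_ρ|`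
    have hr1' : 1 ≤ r := (not_le.1 hr1).le
    have hvolI : volume (I ∩ Ioo 0 T) ≤ ENNReal.ofReal T := by
      calc volume (I ∩ Ioo 0 T) ≤ volume (Ioo (0 : ℝ) T) := measure_mono inter_subset_right
        _ = ENNReal.ofReal T := by rw [Real.volume_Ioo, sub_zero]
    have hmin : (min (volume B) (volume (ball x₀ ρ))) ^ e ≤ (volume (ball x₀ ρ)) ^ e :=
      ENNReal.rpow_le_rpow (min_le_right _ _) he0
    calc Φ * volume (I ∩ Ioo 0 T) ≤ (P * (volume (ball x₀ ρ)) ^ e) * ENNReal.ofReal T :=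
          mul_le_mul' (mul_le_mul' le_rfl hmin) hvolI
      _ = ENNReal.ofReal A₂ := by
          rw [← ENNReal.ofReal_toReal hPt, ← ENNReal.ofReal_toReal hVρt,
            ENNReal.ofReal_rpow_of_nonneg ENNReal.toReal_nonneg he0,
            ← ENNReal.ofReal_mul hP0, ← ENNReal.ofReal_mul (by positivity)]
          congr 1; rw [hA₂]; ring
      _ ≤ ENNReal.ofReal ((A₁ + A₂) * r ^ d) := by
          refine ENNReal.ofReal_le_ofReal ?_
          have hrd : 1 ≤ r ^ d := Real.one_le_rpow hr1' hd0.le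
          calc A₂ = A₂ * 1 := (mul_one _).symm
            _ ≤ (A₁ + A₂) * r ^ d := by gcongr; linarith

/-! ### The near-field pressure of a bounded velocity -/

/-- **The near-field pressure of a bounded velocity is in `L^q`** (`1 < q < ∞`): for a measurable
slice `v(t)` with `|v(t)| ≤ K_b` a.e. on `B(x₀, 2r)`,
`‖localPressureNear x₀ r v t‖_{L^q} ≤ C_q ‖ |1_{B(x₀,2r)} v(t)|² ‖_{L^q} ≤ C_q K_b² |B(x₀,2r)|^{1/q}`
(the Calderón–Zygmund bound `stein1970_normalisedPressure_ae_Lp_bound_holds`).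
[cite: JiaSverak2014, formula (3.3) p. 7] -/
theorem exists_eLpNorm_localPressureNear_le_of_bound {q : ℝ≥0∞} (hq1 : 1 < q) (hqt : q < ⊤) :
    ∃ Cq : ℝ≥0, ∀ {v : ℝ → (EuclideanSpace ℝ (Fin 3)) → (EuclideanSpace ℝ (Fin 3))} {t : ℝ}
      {x₀ : EuclideanSpace ℝ (Fin 3)} {r Kb : ℝ}, 0 ≤ Kb →
      AEStronglyMeasurable (v t) volume →
      (∀ᵐ x ∂(volume : Measure (EuclideanSpace ℝ (Fin 3))), x ∈ ball x₀ (2 * r) → ‖v t x‖ ≤ Kb) →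
      eLpNorm (localPressureNear x₀ r v t) q volume ≤
        Cq * (ENNReal.ofReal (Kb ^ 2) * volume (ball x₀ (2 * r)) ^ (1 / q.toReal)) := by
  obtain ⟨C, hC⟩ := stein1970_normalisedPressure_ae_Lp_bound_holds q hq1 hqt
  refine ⟨C, ?_⟩
  intro v t x₀ r Kb hKb hm hb
  have hqt' : q ≠ ⊤ := hqt.ne
  have hq0 : q ≠ 0 := (zero_lt_one.trans hq1).ne'
  set w : (EuclideanSpace ℝ (Fin 3)) → (EuclideanSpace ℝ (Fin 3)) := (ball x₀ (2 * r)).indicator (v t) with hw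
  have hwm : AEStronglyMeasurable w volume := hm.indicator measurableSet_ball
  -- `‖ |w|² ‖_{L^q} ≤ K_b² |B|^{1/q}`
  have hw2b : ∀ᵐ x ∂(volume : Measure (EuclideanSpace ℝ (Fin 3))), ‖‖w x‖ ^ 2‖ ≤
      (ball x₀ (2 * r)).indicator (fun _ => Kb ^ 2) x := by
    filter_upwards [hb] with x hx
    rw [Real.norm_eq_abs, abs_of_nonneg (sq_nonneg _)]
    by_cases hxB : x ∈ ball x₀ (2 * r)
    · rw [hw, indicator_of_mem hxB, indicator_of_mem hxB]
      exact pow_le_pow_left₀ (norm_nonneg _) (hx hxB) 2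
    · rw [hw, indicator_of_notMem hxB, indicator_of_notMem hxB, norm_zero]
      norm_num
  have hind : eLpNorm ((ball x₀ (2 * r)).indicator (fun _ : EuclideanSpace ℝ (Fin 3) => Kb ^ 2)) q volume =
      ENNReal.ofReal (Kb ^ 2) * volume (ball x₀ (2 * r)) ^ (1 / q.toReal) := by
    rw [eLpNorm_indicator_const measurableSet_ball hq0 hqt', Real.enorm_eq_ofReal (sq_nonneg _)]
  have hw2 : eLpNorm (fun x => ‖w x‖ ^ 2) q volume ≤ ENNReal.ofReal (Kb ^ 2) * volume (ball x₀ (2 * r)) ^ (1 / q.toReal) := by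
    rw [← hind]
    exact eLpNorm_mono_ae_real hw2b
  have hmem : MemLp (fun x => ‖w x‖ ^ 2) q volume := by
    refine ⟨hwm.norm.pow 2, ?_⟩
    refine hw2.trans_lt ?_
    exact ENNReal.mul_lt_top ENNReal.ofReal_lt_top
      (ENNReal.rpow_lt_top_of_nonneg (by positivity) measure_ball_lt_top.ne)
  obtain ⟨-, hCZ⟩ := hC w hwm hmem
  have hnear : localPressureNear x₀ r v t = normalisedPressure w := by
    funext x; rw [localPressureNear_apply]
  rw [hnear]
  exact hCZ.trans (mul_le_mul' le_rfl hw2)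

/-! ### The far-field pressure on the inner ball -/

/-- **The far-field pressure is bounded on the inner ball by the uniformly local energy**
(Jia–Šverák 2014, (3.3): `|K(x-y) - K(x₀-y)| ≤ Cr/|x₀-y|⁴`; Kang–Miura–Tsai 2021 Lemma 3.4): for
`0 < r ≤ 1/2` there is `F = F(r)` such that for every measurable slice with
`∫_{B(z,1)} |v(t)|² ≤ α` for all `z` (`α < ∞`) and every `x ∈ B(x₀, r)`,
`‖localPressureFar x₀ r v t x‖ₑ ≤ F α`. [cite: JiaSverak2014, formula (3.3) p. 7] [cite: KangMiuraTsai2020, Lemma 3.4] -/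
theorem exists_enorm_localPressureFar_le_of_uloc {r : ℝ} (hr : 0 < r) (hr1 : r ≤ 1 / 2) :
    ∃ F : ℝ≥0∞, F ≠ ⊤ ∧ ∀ {v : ℝ → (EuclideanSpace ℝ (Fin 3)) → (EuclideanSpace ℝ (Fin 3))} {t : ℝ}
      {x₀ : EuclideanSpace ℝ (Fin 3)} {α : ℝ≥0∞},
      AEStronglyMeasurable (v t) volume →
      (∀ z : EuclideanSpace ℝ (Fin 3), ∫⁻ y in ball z 1, ‖v t y‖ₑ ^ 2 ≤ α) →
      ∀ x ∈ ball x₀ r, ‖localPressureFar x₀ r v t x‖ₑ ≤ F * α := by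
  obtain ⟨CK, hCK0, hCK⟩ := exists_abs_pressureKernel_sub_le
  obtain ⟨Kt, hKtt, hKtail⟩ := exists_farField_tail_le hr
  refine ⟨ENNReal.ofReal (CK * r) * (Kt * ENNReal.ofReal ((2 * r - r)⁻¹)), ?_, ?_⟩
  · exact ENNReal.mul_ne_top ENNReal.ofReal_ne_top (ENNReal.mul_ne_top hKtt ENNReal.ofReal_ne_top)
  intro v t x₀ α hm hα x hx
  have h1 := enorm_localPressureFar_le hCK0 hCK x₀ hr v t hx
  -- the tail in the form of `exists_farField_tail_le`
  have hαr : ∀ z : EuclideanSpace ℝ (Fin 3), ∫⁻ y in ball z r, ‖v t y‖ₑ ^ (2 : ℕ) ≤ α := fun z =>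
    (lintegral_mono_set (ball_subset_ball (by linarith))).trans (hα z)
  have htail := hKtail (fun y => ‖v t y‖ₑ ^ (2 : ℕ)) (hm.aemeasurable.enorm.pow_const _) α hαr x₀ (2 * r) le_rfl
  have hker : ∀ y : EuclideanSpace ℝ (Fin 3), RieszKernel.powKer 4 (y - x₀) = ENNReal.ofReal ((‖y - x₀‖ ^ 4)⁻¹) := fun y => by
    unfold RieszKernel.powKer
    rw [Real.rpow_neg (norm_nonneg _), show (4 : ℝ) = ((4 : ℕ) : ℝ) by norm_num, Real.rpow_natCast]
  simp_rw [hker] at h1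
  calc ‖localPressureFar x₀ r v t x‖ₑ
      ≤ ENNReal.ofReal (CK * r) * ∫⁻ y in (ball x₀ (2 * r))ᶜ, ‖v t y‖ₑ ^ (2 : ℕ) * ENNReal.ofReal ((‖y - x₀‖ ^ 4)⁻¹) := h1
    _ ≤ ENNReal.ofReal (CK * r) * (Kt * ENNReal.ofReal ((2 * r - r)⁻¹) * α) := mul_le_mul' le_rfl htail
    _ = _ := by ring

end JiaSverak2014

end Literature.Analysis.FluidPDE

end
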